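import Mathlib
import Summits.ValiantsHypothesis.ValiantsHypothesis.Theorems.NewtonUnitEquationsDissociatedUniformProductChart
import Summits.ValiantsHypothesis.ValiantsHypothesis.Theorems.NewtonUnitEquationsDissociatedUniformQuasiPoly

/-!
# `NewtonUnitEquationsNewtonTauWeakAutomatonStep` — carry automaton: the shadow recursion

Rung toward `stub_binomialNewtonTauCommon` (crux `NewtonTauWeak`, stmt-ValiantsHypothesis-5904), line
`binomial-normal-form`, CARRY-AUTOMATON rung: registered stub `stub_autoStep`.

Setting.  On the digit box `E = [0, 2^(h+m))²` the level-`(h+m)` vector configuration `x : E → ℂ^d` is a LINEAR image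
`π` of the Kronecker product of the level-`m` configuration `x₁` on `E₁ = [0, 2^m)²` (high digits `H`) and the level-`h`
configuration `x₂` on `E₂ = [0, 2^h)²` (low digits `L`), positions corresponding under the digit bijection
`(H, L) ↦ 2^h H + L`, `E₁ × E₂ → E` (hypothesis `hx`).

Claim `stub_autoStep`: the configuration shadows (`QuasiPoly.cshadow`, Theorem Q, file
`…DissociatedUniformGreedyCharts.lean`) satisfy `s(E, x) ≤ 2D²(D s(E₁, x₁) + D s(E₂, x₂) + 1) + 2D + 1`, `D = d²`.

Proof.  The Kronecker product `u ⊗ v ∈ ℂ^{d·d}` is the Hadamard product `(u ⊗ 𝟙) * (𝟙 ⊗ v)` of the two LIFTS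
`z₁ H = x₁ H ⊗ 𝟙`, `z₂ L = 𝟙 ⊗ x₂ L`, which are linear images (`LinearMap.funLeft`) of `x₁ H`, `x₂ L`.  Theorem Q's
product step `QuasiPoly.ncard_cshadow_prod_le` bounds the shadow of the product configuration
`(E₁ ×ˢ E₂, z₁ ⊗ z₂)` with ADDED coordinates, the coordinates of the high factor scaled by `2^h` (so that the coordinates
of `(H, L)` are those of `2^h H + L`).  Greedy sets pull back along linear maps of the vectors
(`AutoStepAux.gE_pull`: if `y ∘ ψ = π ∘ z` and `z a` is spanned by higher `z`'s then, applying `π`, so is `y (ψ a)`),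
hence (a) the shadow of `(E, x)` embeds, via the inverse digit map, into the product shadow, and (b) the factor
shadows of the lifts are contained in those of `x₁`, `x₂` — after removing the scaling `2^h > 0` of the coordinates,
which changes neither greedy sets (`QuasiPoly.gE_mul_pos`) nor injectivity of heights (`QuasiPoly.injOn_of_mul`).
[folklore: greedy bases of a matroid]
-/

set_option linter.dupNamespace false

noncomputable section

open scoped BigOperators
open Summit.ValiantsHypothesis.ValiantsHypothesis.Theorems.NewtonUnitEquationsDissociatedUniform.QuasiPoly
  (cshadow gE lin cshadow_finite gE_mul_pos injOn_of_mul ncard_cshadow_prod_le)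

namespace Summit.ValiantsHypothesis.ValiantsHypothesis.Theorems.NewtonTauWeakAutomaton

namespace AutoStepAux

/-- **Greedy elements pull back along a linear map of the vectors.**  If `ψ` maps `E` into `E'` preserving heights
and `y ∘ ψ = π ∘ z` on `E` for a linear map `π`, then `ψ a` greedy for `y` forces `a` greedy for `z`
(apply `π` to a dependence: `Submodule.apply_mem_span_image_of_mem_span`). [folklore] -/
theorem gE_pull {α γ : Type} {k k' : ℕ} (E : Finset α) (E' : Finset γ) (z : α → Fin k → ℂ)
    (y : γ → Fin k' → ℂ) (g : α → ℝ) (g' : γ → ℝ) (π : (Fin k → ℂ) →ₗ[ℂ] (Fin k' → ℂ)) (ψ : α → γ)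
    (hψ : ∀ a ∈ E, ψ a ∈ E') (hy : ∀ a ∈ E, y (ψ a) = π (z a)) (hg : ∀ a ∈ E, g' (ψ a) = g a)
    {a : α} (haE : a ∈ E) (ha : ψ a ∈ gE E' y g') : a ∈ gE E z g := by
  refine ⟨haE, fun hmem => ha.2 ?_⟩
  have h := Submodule.apply_mem_span_image_of_mem_span π hmem
  rw [hy a haE]
  refine Submodule.span_mono ?_ h
  rintro _ ⟨_, ⟨e', ⟨he'E, hlt⟩, rfl⟩, rfl⟩
  exact ⟨ψ e', ⟨hψ e' he'E, by rw [hg a haE, hg e' he'E]; exact hlt⟩, hy e' he'E⟩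

/-- A configuration whose vectors are a linear image of another configuration on the same positions (same
coordinates) has the smaller configuration shadow. [folklore] -/
theorem cshadow_subset_of_linear {α : Type} {k k' : ℕ} (E : Finset α) (z : α → Fin k → ℂ)
    (y : α → Fin k' → ℂ) (X Y : α → ℝ) (π : (Fin k → ℂ) →ₗ[ℂ] (Fin k' → ℂ)) (hy : ∀ a ∈ E, y a = π (z a)) :
    cshadow E y X Y ⊆ cshadow E z X Y := by
  rintro a ⟨w, hinj, ha⟩
  exact ⟨w, hinj, gE_pull E E z y (lin X Y w) (lin X Y w) π id (fun _ h => h) hy (fun _ _ => rfl) ha.1 ha⟩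

/-- Scaling both planar coordinates by a positive constant does not enlarge the configuration shadow. [folklore] -/
theorem cshadow_smul_subset {α : Type} {k : ℕ} (E : Finset α) (z : α → Fin k → ℂ) (X Y : α → ℝ) {c : ℝ}
    (hc : 0 < c) : cshadow E z (fun a => c * X a) (fun a => c * Y a) ⊆ cshadow E z X Y := by
  rintro a ⟨w, hinj, ha⟩
  have hfun : lin (fun a => c * X a) (fun a => c * Y a) w = fun e => c * lin X Y w e := by
    funext e; simp only [lin]; ring
  rw [hfun] at hinj ha
  rw [gE_mul_pos E z (lin X Y w) hc] at ha
  exact ⟨w, injOn_of_mul E _ c hinj, ha⟩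

end AutoStepAux

open AutoStepAux

/-- **The carry-automaton step (shadow recursion).**  If the level-`(h+m)` configuration `x` on the digit box
`E = [0, 2^(h+m))²` is a linear image `π` of the Kronecker product of the configurations `x₁` on `E₁ = [0, 2^m)²` and
`x₂` on `E₂ = [0, 2^h)²` along the digit bijection `(H, L) ↦ 2^h H + L`, then the configuration shadows satisfy
`s(E, x) ≤ 2D²(D s(E₁, x₁) + D s(E₂, x₂) + 1) + 2D + 1` with `D = d²` (Theorem Q's product step
`QuasiPoly.ncard_cshadow_prod_le` for the Hadamard realisation of the Kronecker product in `ℂ^{d·d}`). [folklore] -/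
theorem stub_autoStep {d : ℕ} (h m : ℕ) (E E₁ E₂ : Finset (ℕ × ℕ))
    (hE : E = Finset.range (2 ^ (h + m)) ×ˢ Finset.range (2 ^ (h + m)))
    (hE₁ : E₁ = Finset.range (2 ^ m) ×ˢ Finset.range (2 ^ m))
    (hE₂ : E₂ = Finset.range (2 ^ h) ×ˢ Finset.range (2 ^ h))
    (x x₁ x₂ : ℕ × ℕ → Fin d → ℂ) (π : (Fin (d * d) → ℂ) →ₗ[ℂ] (Fin d → ℂ))
    (hx : ∀ H ∈ E₁, ∀ L ∈ E₂, x (2 ^ h * H.1 + L.1, 2 ^ h * H.2 + L.2) =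
      π (fun ij => x₁ H (finProdFinEquiv.symm ij).1 * x₂ L (finProdFinEquiv.symm ij).2)) :
    (Summit.ValiantsHypothesis.ValiantsHypothesis.Theorems.NewtonUnitEquationsDissociatedUniform.QuasiPoly.cshadow
        E x (fun P => ((P.1 : ℕ) : ℝ)) (fun P => ((P.2 : ℕ) : ℝ))).ncard ≤
      2 * (d * d * (d * d) * (d * d *
          (Summit.ValiantsHypothesis.ValiantsHypothesis.Theorems.NewtonUnitEquationsDissociatedUniform.QuasiPoly.cshadow
            E₁ x₁ (fun P => ((P.1 : ℕ) : ℝ)) (fun P => ((P.2 : ℕ) : ℝ))).ncard +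
        d * d *
          (Summit.ValiantsHypothesis.ValiantsHypothesis.Theorems.NewtonUnitEquationsDissociatedUniform.QuasiPoly.cshadow
            E₂ x₂ (fun P => ((P.1 : ℕ) : ℝ)) (fun P => ((P.2 : ℕ) : ℝ))).ncard + 1)) +
        d * d + d * d + 1 := by
  -- notation: planar coordinates, the scale `c = 2^h`, the lifts `z₁ = x₁ ⊗ 𝟙`, `z₂ = 𝟙 ⊗ x₂`
  set X : ℕ × ℕ → ℝ := fun P => ((P.1 : ℕ) : ℝ) with hXdef
  set Y : ℕ × ℕ → ℝ := fun P => ((P.2 : ℕ) : ℝ) with hYdef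
  set c : ℝ := (2 : ℝ) ^ h with hcdef
  have hc : 0 < c := by positivity
  set z₁ : ℕ × ℕ → Fin (d * d) → ℂ := fun H ij => x₁ H (finProdFinEquiv.symm ij).1 with hz₁
  set z₂ : ℕ × ℕ → Fin (d * d) → ℂ := fun L ij => x₂ L (finProdFinEquiv.symm ij).2 with hz₂
  -- membership in the three boxes
  have hmemE : ∀ P : ℕ × ℕ, P ∈ E ↔ P.1 < 2 ^ (h + m) ∧ P.2 < 2 ^ (h + m) := by
    intro P; rw [hE, Finset.mem_product, Finset.mem_range, Finset.mem_range]
  have hmemE₁ : ∀ P : ℕ × ℕ, P ∈ E₁ ↔ P.1 < 2 ^ m ∧ P.2 < 2 ^ m := by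
    intro P; rw [hE₁, Finset.mem_product, Finset.mem_range, Finset.mem_range]
  have hmemE₂ : ∀ P : ℕ × ℕ, P ∈ E₂ ↔ P.1 < 2 ^ h ∧ P.2 < 2 ^ h := by
    intro P; rw [hE₂, Finset.mem_product, Finset.mem_range, Finset.mem_range]
  -- the digit bijection `ψ (H, L) = 2^h H + L` and its inverse `φ`
  set ψ : (ℕ × ℕ) × (ℕ × ℕ) → ℕ × ℕ := fun p => (2 ^ h * p.1.1 + p.2.1, 2 ^ h * p.1.2 + p.2.2) with hψ
  set φ : ℕ × ℕ → (ℕ × ℕ) × (ℕ × ℕ) :=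
    fun P => ((P.1 / 2 ^ h, P.2 / 2 ^ h), (P.1 % 2 ^ h, P.2 % 2 ^ h)) with hφ
  have hpos : 0 < 2 ^ h := Nat.two_pow_pos h
  have hψφ : ∀ P, ψ (φ P) = P := fun P =>
    Prod.ext (Nat.div_add_mod P.1 (2 ^ h)) (Nat.div_add_mod P.2 (2 ^ h))
  have hφψ : ∀ p : (ℕ × ℕ) × (ℕ × ℕ), p.2.1 < 2 ^ h → p.2.2 < 2 ^ h → φ (ψ p) = p := by
    rintro ⟨⟨a, b⟩, ⟨u, v⟩⟩ hu hv
    simp only [hφ, hψ, Nat.mul_add_div hpos, Nat.div_eq_of_lt hu, Nat.div_eq_of_lt hv, add_zero,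
      Nat.mul_add_mod, Nat.mod_eq_of_lt hu, Nat.mod_eq_of_lt hv]
  have hψE : ∀ p ∈ E₁ ×ˢ E₂, ψ p ∈ E := by
    intro p hp
    obtain ⟨h1, h2⟩ := Finset.mem_product.mp hp
    obtain ⟨ha, hb⟩ := (hmemE₁ _).mp h1
    obtain ⟨hu, hv⟩ := (hmemE₂ _).mp h2
    rw [hmemE, pow_add]
    constructor
    · calc 2 ^ h * p.1.1 + p.2.1 < 2 ^ h * p.1.1 + 2 ^ h := by omega
        _ = 2 ^ h * (p.1.1 + 1) := by ring
        _ ≤ 2 ^ h * 2 ^ m := Nat.mul_le_mul_left _ ha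
    · calc 2 ^ h * p.1.2 + p.2.2 < 2 ^ h * p.1.2 + 2 ^ h := by omega
        _ = 2 ^ h * (p.1.2 + 1) := by ring
        _ ≤ 2 ^ h * 2 ^ m := Nat.mul_le_mul_left _ hb
  have hφE : ∀ P ∈ E, φ P ∈ E₁ ×ˢ E₂ := by
    intro P hP
    obtain ⟨h1, h2⟩ := (hmemE P).mp hP
    rw [pow_add, mul_comm] at h1 h2
    exact Finset.mem_product.mpr ⟨(hmemE₁ _).mpr ⟨(Nat.div_lt_iff_lt_mul hpos).mpr h1,
      (Nat.div_lt_iff_lt_mul hpos).mpr h2⟩, (hmemE₂ _).mpr ⟨Nat.mod_lt _ hpos, Nat.mod_lt _ hpos⟩⟩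
  -- heights: the (scaled, added) coordinates of `(H, L)` are the coordinates of `ψ (H, L)`
  have hlinψ : ∀ (w : Fin 2 → ℝ) (p : (ℕ × ℕ) × (ℕ × ℕ)),
      lin (fun p : (ℕ × ℕ) × (ℕ × ℕ) => c * X p.1 + X p.2) (fun p => c * Y p.1 + Y p.2) w p =
        lin X Y w (ψ p) := by
    intro w p
    simp only [lin, hXdef, hYdef, hψ, hcdef]
    push_cast
    ring
  -- vectors: `x ∘ ψ = π ∘ (z₁ * z₂)` on `E₁ ×ˢ E₂` (Kronecker = Hadamard of the lifts)
  have hxψ : ∀ p ∈ E₁ ×ˢ E₂, x (ψ p) = π (z₁ p.1 * z₂ p.2) := by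
    intro p hp
    obtain ⟨h1, h2⟩ := Finset.mem_product.mp hp
    exact hx p.1 h1 p.2 h2
  -- (a) the shadow of `(E, x)` embeds into the product shadow
  have hA : cshadow E x X Y ⊆ ψ '' cshadow (E₁ ×ˢ E₂) (fun p : (ℕ × ℕ) × (ℕ × ℕ) => z₁ p.1 * z₂ p.2)
      (fun p => c * X p.1 + X p.2) (fun p => c * Y p.1 + Y p.2) := by
    rintro P ⟨w, hinj, hP⟩
    refine ⟨φ P, ⟨w, ?_, ?_⟩, hψφ P⟩
    · intro q hq q' hq' hqq'
      rw [hlinψ, hlinψ] at hqq'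
      have heq := hinj (hψE q hq) (hψE q' hq') hqq'
      obtain ⟨hu, hv⟩ := (hmemE₂ _).mp (Finset.mem_product.mp hq).2
      obtain ⟨hu', hv'⟩ := (hmemE₂ _).mp (Finset.mem_product.mp hq').2
      rw [← hφψ q hu hv, ← hφψ q' hu' hv', heq]
    · exact gE_pull (E₁ ×ˢ E₂) E _ x _ (lin X Y w) π ψ hψE hxψ (fun p _ => (hlinψ w p).symm) (hφE P hP.1)
        (by rw [hψφ]; exact hP)
  have hA' : (cshadow E x X Y).ncard ≤ (cshadow (E₁ ×ˢ E₂) (fun p : (ℕ × ℕ) × (ℕ × ℕ) => z₁ p.1 * z₂ p.2)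
      (fun p => c * X p.1 + X p.2) (fun p => c * Y p.1 + Y p.2)).ncard :=
    (Set.ncard_le_ncard hA ((cshadow_finite _ _ _ _).image ψ)).trans
      (Set.ncard_image_le (cshadow_finite _ _ _ _))
  -- (b) the factor shadows of the lifts are contained in the factor shadows of `x₁`, `x₂`
  have hB : cshadow E₁ z₁ (fun P => c * X P) (fun P => c * Y P) ⊆ cshadow E₁ x₁ X Y :=
    (cshadow_smul_subset E₁ z₁ X Y hc).trans
      (cshadow_subset_of_linear E₁ x₁ z₁ X Y
        (LinearMap.funLeft ℂ ℂ fun ij : Fin (d * d) => (finProdFinEquiv.symm ij).1) fun _ _ => rfl)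
  have hC : cshadow E₂ z₂ X Y ⊆ cshadow E₂ x₂ X Y :=
    cshadow_subset_of_linear E₂ x₂ z₂ X Y
      (LinearMap.funLeft ℂ ℂ fun ij : Fin (d * d) => (finProdFinEquiv.symm ij).2) fun _ _ => rfl
  have hB' := Set.ncard_le_ncard hB (cshadow_finite _ _ _ _)
  have hC' := Set.ncard_le_ncard hC (cshadow_finite _ _ _ _)
  -- the product step
  have hprod := ncard_cshadow_prod_le E₁ E₂ z₁ z₂ (fun P => c * X P) (fun P => c * Y P) X Y
  refine hA'.trans (hprod.trans ?_)
  gcongr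

end Summit.ValiantsHypothesis.ValiantsHypothesis.Theorems.NewtonTauWeakAutomaton

end
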